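import Summits.KontsevichZagierPeriods.KontsevichZagierPeriods.Theses.FurushoPentagon
import Summits.KontsevichZagierPeriods.KontsevichZagierPeriods.Theorems.FurushoPentagonReducedPeriodRingDefs
import Summits.KontsevichZagierPeriods.KontsevichZagierPeriods.Theorems.SymplecticScissorsPlanarAreasStubAreaSlicing
import Literature.NumberTheory.Transcendental.KZCubicalCalculus
import Literature.NumberTheory.Transcendental.KZLogCalculusProofs

/-!
# `SectorToKernel`, line `effective-cube-surjection`: planar volumes go down to dimension one

Stub V1 `stub_planarVolumeToDimOne` (wave 2) of the crux `FurushoPentagon.SectorToKernel`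
(stmt-KontsevichZagierPeriods-10813): a planar Kontsevich–Zagier representation `[K, 1]` (so
`K ⊆ ℝ²` is `ℚ`-semialgebraic of finite area) is, modulo the KZ relations, a finite SUM of
one-dimensional representations. The geometric content — cut `K` along the cylinders over the cells
of a `ℚ`-cylindrical decomposition of the line adapted to `K` (Basu–Pollack–Roy Cor. 5.7, proved in
the tree), discard the null graphs and null cells (rule (1)), and go down each inner band
`ξ_{j-1} < t < ξ_j` by Newton–Leibniz with primitive `t` (rule (3)) to `[C, ξ_j − ξ_{j-1}]` — is the
tree theorem `PlanarAreas.stub_areaSlicing` (route SymplecticScissors), which yields a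
`ℤ`-combination `c` of classes of one-dimensional representations with `[K] − c ∈ relations`. This
file turns the `ℤ`-combination into a plain sum: a negative class `−[w]` is congruent to the class
`[w.neg]` of the representation with the opposite integrand (`[w] + [w.neg]` is a relation, rule (1)),
so the set of formal combinations congruent to a `Fin k`-indexed sum of classes is a subgroup
(`pvol_exists_sum_of_mem_closure`, closure induction). The boundedness hypothesis of the registered
statement is not needed (finite area suffices). References: M. Kontsevich, D. Zagier, *Periods*
(2001), §1.2, rules (1), (3); S. Basu, R. Pollack, M.-F. Roy, *Algorithms in Real Algebraic
Geometry* (2006), Cor. 5.7.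
-/

noncomputable section

namespace Summit.KontsevichZagierPeriods.FurushoPentagon.SectorToKernel

open Set MeasureTheory
open Literature.NumberTheory.Transcendental
open Literature.NumberTheory.Transcendental.KZ hiding cubicalSpan
open Summit.KontsevichZagierPeriods.KontsevichZagierPeriods.Theses.FurushoPentagon
open Summit.KontsevichZagierPeriods.FurushoPentagon.ReducedPeriodRing (unitCube cubicalGens cubicalSpan)

/-- **From `ℤ`-combinations to sums.** Every element of the subgroup of `FormalRep` generated by the
classes of one-dimensional representations is congruent modulo the KZ relations to a finite sum
`∑ i, [w i]` of such classes: sums concatenate (`Fin.append`), and `−[w] ≡ [w.neg]` because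
`[w] + [w.neg]` is a relation (`KZ.of_add_of_neg_mem_levelRel`).
[Kontsevich–Zagier 2001, §1.2, rule (1)] [folklore] -/
theorem pvol_exists_sum_of_mem_closure {c : FormalRep}
    (hc : c ∈ AddSubgroup.closure (Set.range fun s : IntegralRep 1 => of s)) :
    ∃ (k : ℕ) (w : Fin k → IntegralRep 1), c - ∑ i, of (w i) ∈ relations := by
  induction hc using AddSubgroup.closure_induction with
  | mem x hx =>
    obtain ⟨s, rfl⟩ := hx
    exact ⟨1, fun _ => s, by simp [relations.zero_mem]⟩
  | zero => exact ⟨0, Fin.elim0, by simp [relations.zero_mem]⟩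
  | add x y _ _ hx hy =>
    obtain ⟨k₁, w₁, h₁⟩ := hx
    obtain ⟨k₂, w₂, h₂⟩ := hy
    refine ⟨k₁ + k₂, Fin.append w₁ w₂, ?_⟩
    rw [Fin.sum_univ_add]
    simp only [Fin.append_left, Fin.append_right]
    rw [add_sub_add_comm]
    exact relations.add_mem h₁ h₂
  | neg x _ hx =>
    obtain ⟨k, w, h⟩ := hx
    refine ⟨k, fun i => (w i).neg, ?_⟩
    have hneg : ∑ i, (of (w i) + of (w i).neg) ∈ relations :=
      relations.sum_mem fun i _ => levelRel_le_relations (of_add_of_neg_mem_levelRel (w i))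
    have : -x - ∑ i, of (w i).neg = -(x - ∑ i, of (w i)) - ∑ i, (of (w i) + of (w i).neg) := by
      rw [Finset.sum_add_distrib]
      abel
    rw [this]
    exact relations.sub_mem (relations.neg_mem h) hneg

/-- **V1: planar volumes are sums of one-dimensional representations modulo the KZ relations**
(registered stub `stub_planarVolumeToDimOne` of crux stmt-KontsevichZagierPeriods-10813, line
`effective-cube-surjection`). For `K ⊆ ℝ²` `ℚ`-semialgebraic (bounded, of finite area) with integrand
`1` there are one-dimensional representations `w₁, …, w_k` with `[K] − ∑ᵢ [wᵢ] ∈ relations`: area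
slicing along an adapted cylindrical decomposition (rules (1) and (3) with primitive `t`, the tree
theorem `PlanarAreas.stub_areaSlicing`), followed by `pvol_exists_sum_of_mem_closure`.
[Kontsevich–Zagier 2001, §1.2, rules (1), (3); Basu–Pollack–Roy 2006, Cor. 5.7] -/
theorem stub_planarVolumeToDimOne :
    ∀ (K : IntegralRep 2), Bornology.IsBounded K.domain → (∀ x ∈ K.domain, K.integrand x = 1) →
      ∃ (k : ℕ) (w : Fin k → IntegralRep 1), of K - ∑ i, of (w i) ∈ relations := by
  intro K _ hK
  obtain ⟨c, hc, hKc⟩ :=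
    Summit.KontsevichZagierPeriods.SymplecticScissors.PlanarAreas.stub_areaSlicing K hK
  obtain ⟨k, w, hw⟩ := pvol_exists_sum_of_mem_closure hc
  refine ⟨k, w, ?_⟩
  have : of K - ∑ i, of (w i) = (of K - c) + (c - ∑ i, of (w i)) := by abel
  rw [this]
  exact relations.add_mem hKc hw

end Summit.KontsevichZagierPeriods.FurushoPentagon.SectorToKernel
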